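import Mathlib
import HarnessLib
import Summits.CriticalPhenomena.PercolationContinuityZ3.Theses.PercTreeValue
import Literature.Probability.Percolation.BondPercolationSymmetry
import Literature.Probability.Percolation.SiteConnectionTools
import Literature.Probability.Percolation.TwoPointFunction
import Literature.Probability.LatticeModels.LatticeGraphProofs

/-!
# `stub_pairSymm` of line `SketchIdeator2` (crux `TetrahedronDisjointCoexistence`,
# stmt-CriticalPhenomena-7798): the pair symmetry `φ_r`

Registered stub `stub_pairSymm` (S2) of the lead's skeleton
`Cruxes/TetrahedronDisjointCoexistence/Lines/SketchIdeator2.lean`, landed DEF-FREE over tree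
declarations.

With `a_r = (r,r,0)`, `b_r = (r,0,r)`, `c_r = (0,r,r)` in `ℤ³`, `H_r = {x | 2x₂ + 2 ≤ r}`,
`U_r = {x | r + 2 ≤ 2x₂}` and `Conf(R; x, y) = {ω | y ∈ C_ω(x) ∧ C_ω(x) ⊆ R}`:
`τ(b_r, c_r) = τ(0, a_r)` and `P(Conf(U_r; b_r, c_r)) = P(Conf(H_r; 0, a_r))` for
`P = bondPercolation (zdGraph 3) p`, every `p`.

Proof. The rotoreflection `φ_r(x) = (r − x₁, x₀, r − x₂)` is an automorphism of the
nearest-neighbour graph `ℤ³` (it permutes and reflects coordinates, so it preserves the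
`ℓ¹`-distance, `zdGraph_adj_iff_norm_holds`), with `φ_r 0 = b_r`, `φ_r a_r = c_r` and
`(φ_r x)₂ = r − x₂`, so `φ_r⁻¹(U_r) = H_r`. Bond percolation is invariant under graph
automorphisms (`bondPercolation_real_preimage_relabel_iso`: `P {ω | φ '' ω ∈ S} = P(S)`), and the
open graph of `φ '' ω` is isomorphic to that of `ω` along `φ` (`openGraph_relabel_adj_iff`), so
`{ω | φ '' ω ∈ {φ x ↔ φ y}} = {x ↔ y}` and `C_{φ '' ω}(φ x) = φ '' C_ω(x)`; hence the preimages of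
the `b_r / c_r`-side events are exactly the `0 / a_r`-side events.
-/

noncomputable section

namespace Summit.CriticalPhenomena.PercolationContinuityZ3.Theorems.TetrahedronDisjointCoexistence

open MeasureTheory
open Literature.Probability.Percolation Literature.Probability.LatticeModels

/-- Transport of open connections along a relabelling `ω ↦ e '' ω` by a bijection `e`:
`e x ↔ e y` in `e '' ω` iff `x ↔ y` in `ω` (the open graphs are isomorphic along `e`,
`openGraph_relabel_adj_iff`; cf. `preimage_relabel_shift_openConn`). -/
theorem pairSymm_reachable_relabel_iff {V W : Type*} (e : V ≃ W) (ω : BondConfig V) (x y : V) :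
    (openGraph (BondConfig.relabel (sym2Equiv e) ω)).Reachable (e x) (e y) ↔
      (openGraph ω).Reachable x y := by
  let ψ : openGraph ω ≃g openGraph (BondConfig.relabel (sym2Equiv e) ω) :=
    { toEquiv := e, map_rel_iff' := fun {a b} => openGraph_relabel_adj_iff e ω a b }
  exact ψ.reachable_iff

/-- The relabelling `ω ↦ e '' ω` pulls the connection event `{e x ↔ e y}` back to `{x ↔ y}`. -/
theorem pairSymm_preimage_relabel_openConn {V W : Type*} (e : V ≃ W) (x y : V) :
    BondConfig.relabel (sym2Equiv e) ⁻¹' (openConn (e x) (e y) : Set (BondConfig W)) =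
      openConn x y :=
  Set.ext fun ω => pairSymm_reachable_relabel_iff e ω x y

/-- The relabelling `ω ↦ e '' ω` pulls the whole-cluster confinement event
`{e y ∈ C(e x) ∧ C(e x) ⊆ R}` back to `{y ∈ C(x) ∧ C(x) ⊆ e ⁻¹' R}`
(`C_{e '' ω}(e x) = e '' C_ω(x)`). -/
theorem pairSymm_preimage_relabel_confine {V W : Type*} (e : V ≃ W) (R : Set W) (x y : V) :
    BondConfig.relabel (sym2Equiv e) ⁻¹'
        {ω' : BondConfig W | e y ∈ openCluster ω' (e x) ∧ openCluster ω' (e x) ⊆ R} =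
      {ω : BondConfig V | y ∈ openCluster ω x ∧ openCluster ω x ⊆ e ⁻¹' R} := by
  ext ω
  simp only [Set.mem_preimage, Set.mem_setOf_eq, openCluster, Set.subset_def]
  refine and_congr (pairSymm_reachable_relabel_iff e ω x y) ⟨fun h z hz => ?_, fun h z' hz' => ?_⟩
  · exact h (e z) ((pairSymm_reachable_relabel_iff e ω x z).2 hz)
  · obtain ⟨z, rfl⟩ := e.surjective z'
    exact h z ((pairSymm_reachable_relabel_iff e ω x z).1 hz')

/-- **S2 — pair symmetry.** With `a_r = (r,r,0)`, `b_r = (r,0,r)`, `c_r = (0,r,r)`,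
`H_r = {x | 2x₂ + 2 ≤ r}`, `U_r = {x | r + 2 ≤ 2x₂}`: `P(b_r ↔ c_r) = P(0 ↔ a_r)` and
`P(c_r ∈ C(b_r) ⊆ U_r) = P(a_r ∈ C(0) ⊆ H_r)` for `P = bondPercolation (zdGraph 3) p`, by the lattice
automorphism `φ_r(x) = (r − x₁, x₀, r − x₂)` (`φ_r 0 = b_r`, `φ_r a_r = c_r`, `φ_r⁻¹ U_r = H_r`) and
the automorphism invariance of bond percolation (`bondPercolation_real_preimage_relabel_iso`). -/
theorem stub_pairSymm (p : unitInterval) (r : ℕ) :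
    (bondPercolation (zdGraph 3) p).real
        (openConn (![(r : ℤ), 0, (r : ℤ)] : Site 3) ![0, (r : ℤ), (r : ℤ)]) =
      (bondPercolation (zdGraph 3) p).real (openConn (0 : Site 3) ![(r : ℤ), (r : ℤ), 0]) ∧
    (bondPercolation (zdGraph 3) p).real
        {ω | (![0, (r : ℤ), (r : ℤ)] : Site 3) ∈ openCluster ω ![(r : ℤ), 0, (r : ℤ)] ∧
          openCluster ω ![(r : ℤ), 0, (r : ℤ)] ⊆ {x | (r : ℤ) + 2 ≤ 2 * x 2}} =
      (bondPercolation (zdGraph 3) p).real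
        {ω | (![(r : ℤ), (r : ℤ), 0] : Site 3) ∈ openCluster ω 0 ∧
          openCluster ω 0 ⊆ {x | 2 * x 2 + 2 ≤ (r : ℤ)}} := by
  -- `ℓ¹` characterisation of adjacency in `ℤ³`
  have hadj : ∀ x y : Site 3, (zdGraph 3).Adj x y ↔ ∑ i, |x i - y i| = 1 :=
    zdGraph_adj_iff_norm_holds
  have habs : ∀ s t : ℤ, |(r : ℤ) - s - ((r : ℤ) - t)| = |s - t| := by
    intro s t
    rw [abs_sub_comm]
    congr 1
    ring
  -- the rotoreflection `φ_r(x) = (r - x₁, x₀, r - x₂)`, an automorphism of `ℤ³`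
  let φ : zdGraph 3 ≃g zdGraph 3 :=
    { toFun := fun x => ![(r : ℤ) - x 1, x 0, (r : ℤ) - x 2]
      invFun := fun y => ![y 1, (r : ℤ) - y 0, (r : ℤ) - y 2]
      left_inv := fun x => by
        funext i
        fin_cases i <;> simp
      right_inv := fun y => by
        funext i
        fin_cases i <;> simp
      map_rel_iff' := fun {a b} => by
        simp only [Equiv.coe_fn_mk, hadj, Fin.sum_univ_three, Matrix.cons_val_zero,
          Matrix.cons_val_one, Matrix.head_cons, Matrix.cons_val_two, Matrix.tail_cons, habs]
        constructor <;> intro h <;> linarith }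
  have hφ : ∀ x : Site 3, φ x = ![(r : ℤ) - x 1, x 0, (r : ℤ) - x 2] := fun x => rfl
  have hφ0 : φ 0 = ![(r : ℤ), 0, (r : ℤ)] := by
    rw [hφ]
    funext i
    fin_cases i <;> simp
  have hφa : φ ![(r : ℤ), (r : ℤ), 0] = ![0, (r : ℤ), (r : ℤ)] := by
    rw [hφ]
    funext i
    fin_cases i <;> simp
  have hU : φ.toEquiv ⁻¹' {x : Site 3 | (r : ℤ) + 2 ≤ 2 * x 2} = {x | 2 * x 2 + 2 ≤ (r : ℤ)} := by
    ext x
    simp only [Set.mem_preimage, Set.mem_setOf_eq, RelIso.coe_fn_toEquiv, hφ, Matrix.cons_val_two,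
      Matrix.tail_cons, Matrix.head_cons]
    omega
  refine ⟨?_, ?_⟩
  · have h1 := pairSymm_preimage_relabel_openConn φ.toEquiv (0 : Site 3) ![(r : ℤ), (r : ℤ), 0]
    rw [RelIso.coe_fn_toEquiv, hφ0, hφa] at h1
    rw [← h1]
    exact (bondPercolation_real_preimage_relabel_iso φ p _).symm
  · have h2 := pairSymm_preimage_relabel_confine φ.toEquiv {x : Site 3 | (r : ℤ) + 2 ≤ 2 * x 2}
      (0 : Site 3) ![(r : ℤ), (r : ℤ), 0]
    rw [hU, RelIso.coe_fn_toEquiv, hφ0, hφa] at h2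
    rw [← h2]
    exact (bondPercolation_real_preimage_relabel_iso φ p _).symm

end Summit.CriticalPhenomena.PercolationContinuityZ3.Theorems.TetrahedronDisjointCoexistence

end
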